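import Summits.Ventures.YMGap.YM3IR.Clustering
import Summits.Ventures.YMGap.YM3IR.UVInterface
import Literature.MathematicalPhysics.QuantumFieldTheory.Balaban1983to89.T4Spectator
import Literature.MathematicalPhysics.QuantumFieldTheory.Balaban1983to89.MissingProofs
import HarnessLib

/-!
# YM3IR / CarrierBridge — Bałaban's carrier ↔ the tree's Wilson carrier (d = 3): typed, and the seam PROVED

HONEST FRAMING (cell pub-ymgap, track Y4 / YM3-IR, seat ym3ir-theory-1, gen 2).  This file claims NO summit, NO mass gap and
NO part of Bałaban's theorems: it is kernel-checked PLUMBING — the identification of carriers, couplings and laws that any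
use of Bałaban's CMP 102 (1985) as ultraviolet input of an infrared argument makes — about the tree's own Wilson measures.
No axioms, no `sorry`; every hypothesis is a citation AS PRINTED (by tree name) or is labelled ASSUMPTION / CONJECTURE.

WHY THIS IS NOVEL (one sentence).  «`ρ_k dV / Z^ε` is the law of the `k`-fold block average of the `ε`-Wilson field»
(Bałaban, CMP 102 (1985), (2), (6) pp. 256–257) is what every infrared argument fed by Bałaban's ultraviolet stability uses,
yet it was never written as a theorem about the SAME finite-volume Wilson measures a cluster expansion speaks about, with
trace normalisation, coupling dictionary `β = 1/(N g² ε)`, Haar normalisation and measurability conditions explicit; here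
it is (`integral_coarseLaw`), so theory-2's `massGap3_of` and the UV ledger `UVInterface.lean` speak about ONE object.

CONTENTS (namespace `Summit.Ventures.YMGap.YM3IR.CarrierBridge`).  §1 TRANSPORT (PROVED): Bałaban's bonds / plaquettes /
fields of the level-`j` torus ARE the tree's edges / plaquettes / configurations of the torus of side `sitesPerDir j`
(`bondEquiv`, `plaqEquiv`, `configEquiv`; `plaqHol_eq`; `wilsonAction_configEquiv`: tree action `= N ·` Bałaban's — the
factor `N` IS the normalised-trace convention, `GroupModel.reTr_eq`).  §2 COUPLINGS (PROVED): `betaTree 𝔊 S = 1/(N g² ε)`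
(`= β_W/N`, `betaTree_eq` ties it to `Dictionary.betaW_bare_eq`); the printed start (1) IS `e^{−E}·exp(−β·S∘configEquiv)`
(`rho0_eq`).  §3 LAWS (PROVED under labelled assumptions): product Haar ↦ product Haar (`map_configEquiv_fieldMeasure`);
FINE END `∫ F dμ_{Wilson,β} = (Z^ε)⁻¹ ∫ ρ₀ · F∘configEquiv dU` (`integral_wilsonMeasure_betaTree`); COARSE END: the
push-forward of the Wilson law under Bałaban's `n`-fold averaging (`blockMap`, `coarseLaw`) has density `ρ_n/Z^ε` in the
printed weak sense (`integral_coarseLaw`, via the tree's `T4Spectator.integral_mul_eq_integral_mul_comp_iter`).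
§4 FAMILY BOOKKEEPING: the (coupling, volume) pairs print reaches (`BalabanPair`), the target restricted to admissible
pairs (`LatticeMassGap3On`, `MassGap3On`, from theory-2's `LatticeMassGap3` by `latticeMassGap3On_of`), and the AGREEMENT
predicate tying a theory-2 `BlockFamily` to Bałaban's averaging (`AgreesWithAveraging`, HYPOTHESIS SHAPE; its inhabitation
is a CONSTRUCTION item, CMP 98 (10), (15) — never smuggled into an interface).

ASSUMPTIONS, LABELLED.  `hHaar : HaarData.haar = haarProbability G` (Bałaban's Haar DATA is Mathlib's normalised Haar
measure: two presentations of one object); `hA : Measurable (wilsonAction ρ)` (the tree's `measurable_wilsonAction` for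
continuous `ρ`, second-countable `G`); `hav : ∀ j, Measurable (av j).avg`, `hint : ∀ j < n, Integrable ρ_j` (printed: (15)
of CMP 98 is continuous, the densities are bounded by (5) p. 256; the tree's `Averaging` / `RTOpI` do not record it).
References: T. Bałaban, CMP 102 (1985) 255–275 [cite: Balaban1985UV3]; CMP 98 (1985) 17–51 [cite: Balaban1985Averaging];
K. Wilson, PRD 10 (1974) 2445 [cite: Wilson1974]; K. Osterwalder, E. Seiler, Ann. Phys. 110 (1978) 440 [cite: OsterwalderSeiler1978].
-/

noncomputable section

open MeasureTheory
open Literature.MathematicalPhysics.QuantumFieldTheory Balaban1985CMP102 Balaban1985CMP102.Setting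
  Balaban1985CMP102.Theorems
open Literature.MathematicalPhysics.QuantumFieldTheory.Balaban1983to89 (Params PBond Plaq GaugeField GaugeGroup HaarData
  Averaging fieldMeasure Density IsRT)

namespace Summit.Ventures.YMGap.YM3IR.CarrierBridge

/-! ## §1  Transport of carriers: Bałaban's level-`j` torus IS the tree's torus of side `sitesPerDir j` -/

section Transport

variable (P : Params) (j : ℕ) (G : Type) [MeasurableSpace G]

/-- Bałaban's positively oriented bonds `⟨x, μ⟩` of `T^{(j)}` are the tree's edges `(x, μ)` of the torus of side
`sitesPerDir j` (both «site × direction»; the sites are the same type `Fin d → ZMod (2L^{m+K−j})`). [cite: Balaban1985Averaging, p.18 L6–11] -/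
def bondEquiv : PBond P j ≃ Edge P.d (P.sitesPerDir j) where
  toFun b := (b.src, b.dir)
  invFun e := ⟨e.1, e.2⟩
  left_inv _ := rfl
  right_inv _ := rfl

/-- Bałaban's plaquettes `⟨x, μ, ν, μ < ν⟩` are the tree's plaquettes `(x, ⟨(μ, ν), μ < ν⟩)`. [cite: Balaban1985Averaging, (5) p.18] -/
def plaqEquiv : Plaq P j ≃ Plaquette P.d (P.sitesPerDir j) where
  toFun p := (p.src, ⟨(p.μ, p.ν), p.hμν⟩)
  invFun q := ⟨q.1, q.2.1.1, q.2.1.2, q.2.2⟩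
  left_inv _ := rfl
  right_inv _ := rfl

/-- **THE CARRIER TRANSPORT.** Bałaban's gauge fields on `T^{(j)}` (`PBond → G`) and the tree's configurations on the torus
of side `sitesPerDir j` (`Edge → G`) are measurably equivalent, re-indexing along `bondEquiv` (`piCongrLeft`). [folklore] -/
def configEquiv : GaugeField P j G ≃ᵐ GaugeConfig P.d (P.sitesPerDir j) G :=
  MeasurableEquiv.piCongrLeft (fun _ : Edge P.d (P.sitesPerDir j) => G) (bondEquiv P j)

variable {P j G}

/-- Pointwise form of the transport: re-indexing, no casts. [folklore] -/
@[simp] theorem configEquiv_apply (U : GaugeField P j G) (e : Edge P.d (P.sitesPerDir j)) :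
    configEquiv P j G U e = U ⟨e.1, e.2⟩ :=
  MeasurableEquiv.piCongrLeft_apply_apply (bondEquiv P j) (β := fun _ => G) U ⟨e.1, e.2⟩

/-- The two lattice-step conventions agree: Bałaban's `x + e_μ` (`Function.update`) is the tree's `x + Pi.single μ 1`. [folklore] -/
theorem shift_eq (x : Balaban1983to89.Site P j) (μ : Fin P.d) :
    Balaban1983to89.Site.shift x μ = Site.shift (d := P.d) (L := P.sitesPerDir j) x μ := by
  funext i
  rcases eq_or_ne i μ with rfl | h <;> simp [Balaban1983to89.Site.shift, Site.shift, *]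

variable [GaugeGroup G]

/-- Plaquette variables agree: Bałaban's `U(∂p)` (B7 (9)) is the tree's `plaquetteHolonomy` of the transported field. [cite: Balaban1985Averaging, (9) p.18] -/
theorem plaqHol_eq (U : GaugeField P j G) (p : Plaq P j) :
    U.plaqHol p = plaquetteHolonomy (configEquiv P j G U) p.src p.μ p.ν := by
  simp only [Balaban1983to89.GaugeField.plaqHol, plaquetteHolonomy, configEquiv_apply, shift_eq]

/-- **Action dictionary.** The tree's Wilson action `Σ_p (N − Re Tr ρ(U_p))` of the transported field is `N ·` Bałaban's
`A(U) = Σ_p (1 − Re tr U(∂p))` (NORMALISED trace, `GroupModel.reTr_eq`, cell reading F11). [cite: Balaban1985UV3, (1) p.256] -/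
theorem wilsonAction_configEquiv (𝔊 : GroupModel G) (U : GaugeField P j G) :
    wilsonAction 𝔊.ρ (configEquiv P j G U) = 𝔊.N * Balaban1983to89.wilsonAction4 U := by
  unfold wilsonAction Balaban1983to89.wilsonAction4 Balaban1983to89.wilsonAction
  rw [Finset.mul_sum, ← (plaqEquiv P j).sum_comp]
  refine Finset.sum_congr rfl fun p _ => ?_
  have hN : (𝔊.N : ℝ) ≠ 0 := by exact_mod_cast 𝔊.N_pos.ne'
  rw [𝔊.reTr_eq, Balaban1983to89.UnitaryModel.nReTr, plaqHol_eq, Fintype.card_fin]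
  simp only [plaqEquiv, Equiv.coe_fn_mk]
  field_simp

end Transport

/-! ## §2  The coupling dictionary: `β_tree = 1/(N g² ε)` and the printed start (1) -/

section Couplings

variable {L : ℕ} {G : Type} [GaugeGroup G] [MeasurableSpace G]

/-- The transport at `d = 3` for an approximation `S`: the same `configEquiv`, its type stated with the literal `3` the IR
side uses (`S.P.d` reduces to `3`; `Setting.params3`). -/
abbrev transport (S : Scales L) (G : Type) [MeasurableSpace G] (n : ℕ) :
    GaugeField S.P n G ≃ᵐ GaugeConfig 3 (S.P.sitesPerDir n) G :=
  configEquiv S.P n G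

/-- `wilsonAction_configEquiv` at `d = 3` for an approximation `S`. [cite: Balaban1985UV3, (1) p.256] -/
theorem wilsonAction_transport (𝔊 : GroupModel G) (S : Scales L) (n : ℕ) (U : GaugeField S.P n G) :
    wilsonAction (d := 3) (L := S.P.sitesPerDir n) 𝔊.ρ (transport S G n U) = 𝔊.N * Balaban1983to89.wilsonAction4 U :=
  wilsonAction_configEquiv 𝔊 U

/-- The tree's ('t Hooft-normalised) Wilson coupling of Bałaban's approximation `S` in the group model `𝔊`:
`β = 1/(N g₀²) = 1/(N g² ε)` — so that `exp(−β · S_Wilson,tree) = exp(−A/g₀²)` (by `wilsonAction_configEquiv`). [cite: Balaban1985UV3, (1) p.256] -/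
def betaTree (𝔊 : GroupModel G) (S : Scales L) : ℝ := ((𝔊.N : ℝ) * S.g0sq)⁻¹

/-- `β_tree > 0` (`g₀² = g²ε > 0`, cf. `Balaban3D.Proofs.ScalesArithmetic.g0sq_pos`). [folklore] -/
theorem betaTree_pos (𝔊 : GroupModel G) (S : Scales L) : 0 < betaTree 𝔊 S :=
  inv_pos.2 (mul_pos (by exact_mod_cast 𝔊.N_pos) (mul_pos (pow_pos S.g_pos 2) S.ε_pos))

/-- Units line to `UVInterface.lean`: `β_tree = β_W / N`, `β_W = 1/(g²ε) = L^K/γ₀²` (`Dictionary.betaW_bare_eq`). [cite: Balaban1985UV3, (1) p.256] -/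
theorem betaTree_eq (𝔊 : GroupModel G) (S : Scales L) :
    betaTree 𝔊 S = ((L : ℝ) ^ S.K / Dictionary.gammaSq S) / 𝔊.N := by
  rw [← Dictionary.betaW_bare_eq, betaTree, Scales.g0sq, mul_inv, mul_comm]
  rfl

variable [HaarData G] {S : Scales L}

/-- **The printed start (1) on the tree's carrier.** `ρ₀(U) = exp[−A(U)/g₀² − E]` IS `e^{−E} · exp(−β_tree · S_Wilson,tree(configEquiv U))`. [cite: Balaban1985UV3, (1) p.256] -/
theorem rho0_eq (𝔊 : GroupModel G) (R : RunObjects S G) (U : GaugeField S.P 0 G) :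
    R.rho0 U = Real.exp (-R.E) *
      Real.exp (-(betaTree 𝔊 S) * wilsonAction (d := 3) (L := S.P.sitesPerDir 0) 𝔊.ρ (transport S G 0 U)) := by
  rw [wilsonAction_transport, ← Real.exp_add]
  show Real.exp _ = Real.exp _
  congr 1
  have hN : (𝔊.N : ℝ) ≠ 0 := by exact_mod_cast 𝔊.N_pos.ne'
  have hg : S.g0sq ≠ 0 := (mul_pos (pow_pos S.g_pos 2) S.ε_pos).ne'
  unfold betaTree; field_simp; ring

/-- `0 < ρ₀`. [folklore] -/
theorem rho0_pos (R : RunObjects S G) (U : GaugeField S.P 0 G) : 0 < R.rho0 U := Real.exp_pos _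

/-- `ρ₀ ≤ e^{−E}` (`wilsonAction4_nonneg`). [folklore] -/
theorem rho0_le (R : RunObjects S G) (U : GaugeField S.P 0 G) : R.rho0 U ≤ Real.exp (-R.E) := by
  refine Real.exp_le_exp.2 ?_
  have h1 : 0 ≤ (1 / S.g0sq) * Balaban1983to89.wilsonAction4 U :=
    mul_nonneg (by have := mul_pos (pow_pos S.g_pos 2) S.ε_pos; positivity) (Balaban1983to89.wilsonAction4_nonneg U)
  linarith

end Couplings

/-! ## §3  Laws: product Haar ↦ product Haar; Wilson law = `ρ₀ dU / Z^ε`; the `n`-step coarse law = `ρ_n dV / Z^ε` -/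

section Densities

variable {L : ℕ} {G : Type} [GaugeGroup G] [MeasurableSpace G] [HaarData G]

variable {S : Scales L}

/-- `ρ₀` is measurable once the tree's Wilson action is (via `rho0_eq`). [folklore] -/
theorem measurable_rho0 (𝔊 : GroupModel G) (R : RunObjects S G)
    (hA : Measurable (wilsonAction (d := 3) (L := S.P.sitesPerDir 0) (G := G) 𝔊.ρ)) : Measurable R.rho0 := by
  have h : R.rho0 = fun U => Real.exp (-R.E) *
      Real.exp (-(betaTree 𝔊 S) * wilsonAction 𝔊.ρ (transport S G 0 U)) := funext (rho0_eq 𝔊 R)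
  rw [h]
  exact measurable_const.mul (Real.measurable_exp.comp (((hA.comp (transport S G 0).measurable)).const_mul _))

/-- `ρ₀` is integrable for product Haar (bounded by `e^{−E}`, measurable). [folklore] -/
theorem integrable_rho0 (𝔊 : GroupModel G) (R : RunObjects S G)
    (hA : Measurable (wilsonAction (d := 3) (L := S.P.sitesPerDir 0) (G := G) 𝔊.ρ)) :
    Integrable R.rho0 (fieldMeasure S.P 0 G) := by
  haveI : IsProbabilityMeasure (fieldMeasure S.P 0 G) := Balaban1983to89.Missing.isProbabilityMeasure_fieldMeasure S.P 0
  refine Integrable.mono' (integrable_const (Real.exp (-R.E))) (measurable_rho0 𝔊 R hA).aestronglyMeasurable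
    (ae_of_all _ fun U => ?_)
  rw [Real.norm_eq_abs, abs_of_pos (rho0_pos R U)]; exact rho0_le R U

/-- `Z^ε > 0`. [folklore] -/
theorem Zeps_pos (𝔊 : GroupModel G) (R : RunObjects S G)
    (hA : Measurable (wilsonAction (d := 3) (L := S.P.sitesPerDir 0) (G := G) 𝔊.ρ)) : 0 < R.Zeps := by
  haveI : IsProbabilityMeasure (fieldMeasure S.P 0 G) := Balaban1983to89.Missing.isProbabilityMeasure_fieldMeasure S.P 0
  unfold RunObjects.Zeps
  rw [integral_pos_iff_support_of_nonneg (fun U => (rho0_pos R U).le) (integrable_rho0 𝔊 R hA)]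
  have hsupp : Function.support R.rho0 = Set.univ := by ext U; simp [(rho0_pos R U).ne']
  rw [hsupp, measure_univ]; exact one_pos

/-- Bałaban's `n`-fold block-averaging map `U ↦ Ū^n` (CMP 98 (10), (15); `Averaging.iter`) AS THE TREE SEES IT: fine Wilson
configurations of the torus of side `2L^{m+K}` to coarse configurations of the torus of side `2L^{m+K−n}`. [cite: Balaban1985Averaging, (15) p.19] -/
def blockMap (R : RunObjects S G) (n : ℕ) : GaugeConfig 3 (S.P.sitesPerDir 0) G → GaugeConfig 3 (S.P.sitesPerDir n) G :=
  transport S G n ∘ Averaging.iter R.av n ∘ (transport S G 0).symm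

/-- `blockMap` is measurable when each one-step averaging is (ASSUMPTION `hav`, labelled). [folklore] -/
theorem measurable_blockMap (R : RunObjects S G) (hav : ∀ j, Measurable (R.av j).avg) (n : ℕ) :
    Measurable (blockMap R n) :=
  (transport S G n).measurable.comp
    ((Balaban1983to89.T4Continuum.measurable_iter R.av hav n).comp (transport S G 0).symm.measurable)

/-- Along a run, the printed densities (2) `ρ_{k+1} = Tρ_k` form a chain of renormalization transforms in the tree's weak
sense as soon as they are integrable (`RTOpI.isRT`; ASSUMPTION `hint`, labelled). [cite: Balaban1985UV3, (2) p.256] -/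
theorem isRTChain_rho (R : RunObjects S G) (n : ℕ)
    (hint : ∀ j, j < n → Integrable (R.rho j) (fieldMeasure S.P j G)) :
    Balaban1983to89.T4Spectator.IsRTChain R.av R.rho n :=
  fun j hj => (R.T j).isRT (R.rho j) (hint j hj)

end Densities

section Laws

variable {L : ℕ} {G : Type} [GaugeGroup G] [MeasurableSpace G] [HaarData G] [TopologicalSpace G]
  [IsTopologicalGroup G] [CompactSpace G] [BorelSpace G]

/-- **Haar transport.** ASSUMPTION `hHaar` (labelled): Bałaban's Haar DATA is Mathlib's normalised Haar measure.  Then the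
product Haar measure `dU = Π_b dU(b)` (B7 (10)) transports along `configEquiv` to the tree's product Haar measure on
configurations. [cite: Balaban1985Averaging, (10) p.19] -/
theorem map_configEquiv_fieldMeasure (P : Params) (j : ℕ) (hHaar : (HaarData.haar : Measure G) = haarProbability G) :
    (fieldMeasure P j G).map (configEquiv P j G) =
      Measure.pi fun _ : Edge P.d (P.sitesPerDir j) => haarProbability G := by
  haveI : IsProbabilityMeasure (HaarData.haar : Measure G) := HaarData.isProb
  rw [← hHaar]
  exact Measure.pi_map_piCongrLeft (bondEquiv P j) fun _ : Edge P.d (P.sitesPerDir j) => (HaarData.haar : Measure G)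

variable {S : Scales L}

/-- **THE FINE END OF THE SEAM (PROVED).** At `β = betaTree 𝔊 S = 1/(N g² ε)` the tree's Wilson law of the torus of side
`2L^{m+K}` integrates every `F` exactly as Bałaban's normalised start `ρ₀ dU / Z^ε` integrates `F ∘ configEquiv`:
`∫ F dμ_{Wilson,β} = (Z^ε)⁻¹ ∫ ρ₀(U) F(configEquiv U) dU`.  Assumptions: `hHaar` (Haar data = Haar measure), `hA`
(measurability of the tree action; `measurable_wilsonAction`). [cite: Balaban1985UV3, (1) and (6) pp.256–257] -/
theorem integral_wilsonMeasure_betaTree (𝔊 : GroupModel G) (R : RunObjects S G)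
    (hHaar : (HaarData.haar : Measure G) = haarProbability G)
    (hA : Measurable (wilsonAction (d := 3) (L := S.P.sitesPerDir 0) (G := G) 𝔊.ρ))
    (F : GaugeConfig 3 (S.P.sitesPerDir 0) G → ℝ) :
    ∫ V, F V ∂(wilsonMeasure (d := 3) (L := S.P.sitesPerDir 0) 𝔊.ρ (betaTree 𝔊 S)) =
      (R.Zeps)⁻¹ * ∫ U, R.rho0 U * F (transport S G 0 U) ∂(fieldMeasure S.P 0 G) := by
  haveI : IsProbabilityMeasure (fieldMeasure S.P 0 G) := Balaban1983to89.Missing.isProbabilityMeasure_fieldMeasure S.P 0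
  have hπ : (fieldMeasure S.P 0 G).map (transport S G 0) =
      Measure.pi fun _ : Edge 3 (S.P.sitesPerDir 0) => haarProbability G :=
    map_configEquiv_fieldMeasure S.P 0 hHaar
  have hw : Measurable fun V : GaugeConfig 3 (S.P.sitesPerDir 0) G =>
      ENNReal.ofReal (Real.exp (-(betaTree 𝔊 S) * wilsonAction 𝔊.ρ V)) :=
    (Real.measurable_exp.comp (hA.const_mul _)).ennreal_ofReal
  have hdens : ∀ U : GaugeField S.P 0 G,
      Real.exp (-(betaTree 𝔊 S) * wilsonAction 𝔊.ρ (transport S G 0 U)) = Real.exp R.E * R.rho0 U := fun U => by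
    rw [rho0_eq 𝔊 R U, ← mul_assoc, ← Real.exp_add, add_neg_cancel, Real.exp_zero, one_mul]
  have hint : Integrable (fun U => Real.exp R.E * R.rho0 U) (fieldMeasure S.P 0 G) :=
    (integrable_rho0 𝔊 R hA).const_mul _
  have hZ : partitionFunction (d := 3) (L := S.P.sitesPerDir 0) 𝔊.ρ (betaTree 𝔊 S) =
      ENNReal.ofReal (Real.exp R.E * R.Zeps) := by
    have h1 : partitionFunction (d := 3) (L := S.P.sitesPerDir 0) 𝔊.ρ (betaTree 𝔊 S) =
        ∫⁻ V, ENNReal.ofReal (Real.exp (-(betaTree 𝔊 S) * wilsonAction 𝔊.ρ V))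
          ∂(Measure.pi fun _ : Edge 3 (S.P.sitesPerDir 0) => haarProbability G) := by
      simp only [partitionFunction, wilsonWeight, withDensity_apply _ MeasurableSet.univ, Measure.restrict_univ]
    rw [h1, ← hπ, lintegral_map_equiv, RunObjects.Zeps, ← integral_const_mul,
      ofReal_integral_eq_lintegral_ofReal hint (ae_of_all _ fun U =>
        mul_nonneg (Real.exp_nonneg _) (rho0_pos R U).le)]
    exact lintegral_congr fun U => by rw [hdens]
  have hstep1 : ∫ V, F V ∂(wilsonMeasure (d := 3) (L := S.P.sitesPerDir 0) 𝔊.ρ (betaTree 𝔊 S)) =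
      ((partitionFunction (d := 3) (L := S.P.sitesPerDir 0) 𝔊.ρ (betaTree 𝔊 S))⁻¹).toReal *
        ∫ V, (ENNReal.ofReal (Real.exp (-(betaTree 𝔊 S) * wilsonAction 𝔊.ρ V))).toReal * F V
          ∂(Measure.pi fun _ : Edge 3 (S.P.sitesPerDir 0) => haarProbability G) := by
    simp only [wilsonMeasure, integral_smul_measure, smul_eq_mul, wilsonWeight]
    rw [integral_withDensity_eq_integral_toReal_smul hw (ae_of_all _ fun V => ENNReal.ofReal_lt_top)]
    rfl
  have hstep2 : ∫ V, (ENNReal.ofReal (Real.exp (-(betaTree 𝔊 S) * wilsonAction 𝔊.ρ V))).toReal * F V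
      ∂(Measure.pi fun _ : Edge 3 (S.P.sitesPerDir 0) => haarProbability G) =
        Real.exp R.E * ∫ U, R.rho0 U * F (transport S G 0 U) ∂(fieldMeasure S.P 0 G) := by
    rw [← hπ, integral_map_equiv, ← integral_const_mul]
    refine integral_congr_ae (ae_of_all _ fun U => ?_)
    dsimp only
    rw [ENNReal.toReal_ofReal (Real.exp_nonneg _), hdens, mul_assoc]
  rw [hstep1, hstep2, hZ, ENNReal.toReal_inv,
    ENNReal.toReal_ofReal (mul_nonneg (Real.exp_nonneg _) (Zeps_pos 𝔊 R hA).le),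
    mul_inv, mul_mul_mul_comm, inv_mul_cancel₀ (Real.exp_ne_zero _), one_mul]

/-- **The coarse (effective) law after `n` steps, on the tree's carrier:** the push-forward of the Wilson law at
`β = betaTree 𝔊 S` under `blockMap R n` — theory-2's `coarseFamily` evaluated on Bałaban's named averaging. [cite: Balaban1985UV3, (2) p.256] -/
def coarseLaw (𝔊 : GroupModel G) (R : RunObjects S G) (n : ℕ) : Measure (GaugeConfig 3 (S.P.sitesPerDir n) G) :=
  (wilsonMeasure (d := 3) (L := S.P.sitesPerDir 0) 𝔊.ρ (betaTree 𝔊 S)).map (blockMap R n)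

/-- **THE COARSE END OF THE SEAM (PROVED) — CMP 102 (2)+(6) about the tree's Wilson measure.** For bounded measurable
`F` on coarse configurations, `∫ F d(coarseLaw) = (Z^ε)⁻¹ ∫ ρ_n(V) F(configEquiv V) dV`: the law of the `n`-fold block
average of the `ε`-Wilson field at `β = 1/(N g² ε)` has density `ρ_n / Z^ε` against product Haar, in the printed
push-forward sense.  Assumptions: `hHaar`, `hA`, `hav`, `hint` (all labelled above). [cite: Balaban1985UV3, (2) and (6) pp.256–257] -/
theorem integral_coarseLaw (𝔊 : GroupModel G) (R : RunObjects S G)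
    (hHaar : (HaarData.haar : Measure G) = haarProbability G)
    (hA : Measurable (wilsonAction (d := 3) (L := S.P.sitesPerDir 0) (G := G) 𝔊.ρ))
    (hav : ∀ j, Measurable (R.av j).avg) (n : ℕ)
    (hint : ∀ j, j < n → Integrable (R.rho j) (fieldMeasure S.P j G))
    (F : GaugeConfig 3 (S.P.sitesPerDir n) G → ℝ) (hF : Measurable F) (hFb : ∃ C : ℝ, ∀ V, |F V| ≤ C) :
    ∫ V, F V ∂(coarseLaw 𝔊 R n) =
      (R.Zeps)⁻¹ * ∫ V, R.rho n V * F (transport S G n V) ∂(fieldMeasure S.P n G) := by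
  obtain ⟨C, hC⟩ := hFb
  have h := Balaban1983to89.T4Spectator.integral_mul_eq_integral_mul_comp_iter R.av hav R.rho n
    (isRTChain_rho R n hint) (fun V => F (transport S G n V)) (hF.comp (transport S G n).measurable)
    ⟨C, fun V => hC _⟩
  unfold coarseLaw
  rw [integral_map (measurable_blockMap R hav n).aemeasurable hF.aestronglyMeasurable,
    integral_wilsonMeasure_betaTree 𝔊 R hHaar hA]
  congr 1
  refine Eq.trans ?_ h.symm
  refine integral_congr_ae (ae_of_all _ fun U => ?_)
  dsimp only [blockMap, Function.comp_apply]
  rw [MeasurableEquiv.symm_apply_apply]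
  rfl

end Laws

/-! ## §4  Family bookkeeping: which (coupling, volume) pairs print reaches, and the agreement predicate -/

section Family

variable {L : ℕ} {G : Type} [GaugeGroup G] [MeasurableSpace G] {N : ℕ}

/-- **The (coupling, fine volume) pairs Bałaban's printed family reaches** at terminal spacing `eps0` in the model `𝔊`:
`(β, M) = (1/(N g² ε), 2L^{m+K})` for an approximation `S` with `L^K ε = eps0(g)` — per `g` a GEOMETRIC sequence of `β`'s
(ratio `L`) and sides `2L^j`, never all sides `M`; `LatticeMassGap3` (theory-2) quantifies over ALL `β ≥ β₁`, ALL `M ≥ 3`. [cite: Balaban1985UV3, p.256 L15–18] -/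
def BalabanPair (𝔊 : GroupModel G) (eps0 : ℝ → ℝ) (β : ℝ) (M : ℕ) : Prop :=
  ∃ S : Family L eps0, betaTree 𝔊 S.1 = β ∧ S.1.P.sitesPerDir 0 = M

variable [TopologicalSpace G] [IsTopologicalGroup G] [CompactSpace G] [BorelSpace G]

/-- **The target restricted to an admissible set of (coupling, side) pairs** (clustering clause and constants discipline of
theory-2's `LatticeMassGap3`; `adm := ⊤` gives it back, `latticeMassGap3On_top_iff`); with `adm := BalabanPair 𝔊 eps0` it is
what an infrared theorem fed by `BalabanUV3` concludes WITHOUT a volume / coupling interpolation (not elementary: clustering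
constants are not monotone in the side).  CONJECTURE-SHAPE; nothing asserted. [cite: OsterwalderSeiler1978, §3] -/
@[conjecture] def LatticeMassGap3On (adm : ℝ → ℕ → Prop) (r : G → G → ℝ) (ρ : G →* Matrix (Fin N) (Fin N) ℂ) (m₀ β₁ : ℝ) :
    Prop :=
  ∀ β : ℝ, β₁ ≤ β → ∃ A : ℝ, ∀ (M : ℕ) [NeZero M], 3 ≤ M → adm β M →
    ClustersWith r (wilsonMeasure (d := 3) (L := M) ρ β) A (m₀ / β)

/-- `MassGap3On adm`: some `m₀ > 0`, `β₁` with `LatticeMassGap3On adm`. CONJECTURE-SHAPE; nothing asserted. -/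
@[conjecture] def MassGap3On (adm : ℝ → ℕ → Prop) (r : G → G → ℝ) (ρ : G →* Matrix (Fin N) (Fin N) ℂ) : Prop :=
  ∃ m₀ : ℝ, 0 < m₀ ∧ ∃ β₁ : ℝ, LatticeMassGap3On adm r ρ m₀ β₁

/-- The unrestricted target implies every restricted one (bookkeeping). -/
theorem latticeMassGap3On_of {r : G → G → ℝ} {ρ : G →* Matrix (Fin N) (Fin N) ℂ} {m₀ β₁ : ℝ}
    (h : LatticeMassGap3 r ρ m₀ β₁) (adm : ℝ → ℕ → Prop) : LatticeMassGap3On adm r ρ m₀ β₁ := by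
  intro β hβ; obtain ⟨A, hA⟩ := h β hβ; exact ⟨A, fun M _ hM _ => hA M hM⟩

/-- `MassGap3 → MassGap3On adm` (bookkeeping). -/
theorem massGap3On_of {r : G → G → ℝ} {ρ : G →* Matrix (Fin N) (Fin N) ℂ} (h : MassGap3 r ρ)
    (adm : ℝ → ℕ → Prop) : MassGap3On adm r ρ := by
  obtain ⟨m₀, hm, β₁, h⟩ := h
  exact ⟨m₀, hm, β₁, latticeMassGap3On_of h adm⟩

/-- With every pair admissible the restricted target IS theory-2's `LatticeMassGap3` (bookkeeping). -/
theorem latticeMassGap3On_top_iff {r : G → G → ℝ} {ρ : G →* Matrix (Fin N) (Fin N) ℂ} {m₀ β₁ : ℝ} :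
    LatticeMassGap3On (fun _ _ => True) r ρ m₀ β₁ ↔ LatticeMassGap3 r ρ m₀ β₁ :=
  ⟨fun h β hβ => by obtain ⟨A, hA⟩ := h β hβ; exact ⟨A, fun M _ hM => hA M hM trivial⟩,
    fun h => latticeMassGap3On_of h _⟩

variable [HaarData G]

/-- **AGREEMENT PREDICATE (HYPOTHESIS SHAPE, never asserted; CONJECTURE as to its inhabitation).** A block family `W` of
theory-2 AGREES with Bałaban's averaging of the construction `mk` (model `𝔊`, terminal spacing `eps0`) if, whenever a
family member `S` at level `n ≤ K` has W's block factor (`b(β_S)·2L^{m+K−n} = 2L^{m+K}`), W's coarse law at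
`(β_S, 2L^{m+K−n})` IS the push-forward of the Wilson law under Bałaban's `n`-fold averaging (`coarseLaw`); then
`integral_coarseLaw` makes theory-2's `coarseFamily ρ β W` and the UV ledger's `ρ_n dV/Z^ε` ONE object.  Inhabitation by the
averaging (15) of CMP 98 is a CONSTRUCTION statement (measurability, block factor `L^n`), owed. [cite: Balaban1985Averaging, (15) p.19] -/
@[conjecture] def AgreesWithAveraging (W : BlockFamily G) (mk : Construction L) (𝔊 : GroupModel G) (eps0 : ℝ → ℝ) : Prop :=
  ∀ (S : Family L eps0) (n : ℕ), n ≤ S.1.K →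
    W.factor (betaTree 𝔊 S.1) * S.1.P.sitesPerDir n = S.1.P.sitesPerDir 0 →
      coarseFamily 𝔊.ρ (betaTree 𝔊 S.1) W (S.1.P.sitesPerDir n) = coarseLaw 𝔊 (mk G 𝔊 S.1) n

/-- **What agreement buys (PROVED):** for an agreeing block family, membership of theory-2's coarse law in Y2's ball at a
Bałaban pair is membership of Bałaban's `ρ_n dV / Z^ε` (merge record M3, now a rewrite). -/
theorem mem_coarseFamily_iff {W : BlockFamily G} {mk : Construction L} {𝔊 : GroupModel G} {eps0 : ℝ → ℝ}
    (hW : AgreesWithAveraging W mk 𝔊 eps0) (B : BallSpec G 𝔊.N) (S : Family L eps0) (n : ℕ) (hn : n ≤ S.1.K)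
    (hb : W.factor (betaTree 𝔊 S.1) * S.1.P.sitesPerDir n = S.1.P.sitesPerDir 0) :
    B.Mem (S.1.P.sitesPerDir n) (coarseFamily 𝔊.ρ (betaTree 𝔊 S.1) W (S.1.P.sitesPerDir n)) ↔
      B.Mem (S.1.P.sitesPerDir n) (coarseLaw 𝔊 (mk G 𝔊 S.1) n) := by
  rw [hW S n hn hb]

end Family

end Summit.Ventures.YMGap.YM3IR.CarrierBridge

end
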